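import Mathlib.NumberTheory.RamificationInertia.Valuation
import Mathlib.NumberTheory.NumberField.InfinitePlace.Ramification
import Literature.AlgebraicGeometry.Frobenioids.ArithmeticDivisors
import HarnessLib

/-!
# Frobenioids I, Example 6.3: functoriality of (effective) arithmetic divisors — the pull-back along an
# embedding of number fields (CONSTRUCTION)

Mochizuki, *The geometry of Frobenioids I*, Kyushu J. Math. **62** (2008), Example 6.3, kurims text p. 113:
"`Φ`, `B`, as well as the homomorphism `B → Φ^gp`, are *functorial* [in the evident sense] with respect to
arrows of `D`" [the finite extensions `Spec L → Spec M` of number fields].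
[cite: MochizukiFrdI2008, Ex. 6.3 p.113]

CONSTRUCTED here (seat abc-iut-L6-t10, "Ex. 6.3 construction binding", over abc-iut-L1-t3's
`ArithmeticDivisors.lean`): for an embedding `σ : M →+* L` of number fields, the pull-back
`EffArithDivisor.pullback σ : Φ(M) →+ Φ(L)` and `ArithDivisor.pullback σ : Φ(M)^gp →+ Φ(L)^gp`. At a
finite place `w` of `L` over `v = σ⁻¹ w` the coefficient of `v` is multiplied by the ramification index
`e(w|v)` (Mathlib `Ideal.ramificationIdx'` of `𝓞 M → 𝓞 L`); at an archimedean place `w` the coordinate of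
`w|_M` (`InfinitePlace.comap`) is copied — in the dictionary of `ArithmeticDivisors.lean` the archimedean
coordinate is `-log |·|_w` for Mathlib's normalised absolute value, which restricts along `σ` without
multiplicity. PROVED: additivity, functoriality `pullback_id` / `pullback_comp` (via uniformizers and Mathlib's
`HeightOneSpectrum.valuation_liesOver`), compatibility with `Φ ⊆ Φ^gp` (`toArithDivisor_pullback`) and with
principal divisors (`pullback_principalArithDivisor`: `σ^* div(f) = div(σ f)`, i.e. `ord_w(σ f) = e(w|v)·ord_v(f)`
and `|σ f|_w = |f|_{w|_M}`). The instantiation of abc-iut-L1-t3's interface `ArithDivisorMonoidOn F K` by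
these maps lives with `ArithmeticFrobenioids.lean`'s companion. Nothing here is specific to abc.
-/

noncomputable section

namespace Literature.AlgebraicGeometry.Frobenioids

open NumberField IsDedekindDomain

universe u₁ u₂ u₃

variable {M : Type u₁} [Field M] [NumberField M] {L : Type u₂} [Field L] [NumberField L]
variable {N : Type u₃} [Field N] [NumberField N]

namespace ArithPullback

/-! ### Primes below, ramification indices and valuations along `σ : M →+* L` -/

omit [NumberField M] [NumberField L] in
/-- The induced map of rings of integers is injective. [cite: MochizukiFrdI2008, Ex. 6.3 p.113] -/
theorem mapRingHom_injective (σ : M →+* L) : Function.Injective (RingOfIntegers.mapRingHom σ) :=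
  fun x y h => RingOfIntegers.ext (σ.injective (by
    have := congrArg (fun z : 𝓞 L => (z : L)) h
    simpa using this))

/-- The prime `σ⁻¹ w` of `M` below a prime `w` of `L` along `σ` (Mathlib's `HeightOneSpectrum.under` for
the algebra structure `σ`). [cite: MochizukiFrdI2008, Ex. 6.3 p.113] -/
def under (σ : M →+* L) (w : HeightOneSpectrum (𝓞 L)) : HeightOneSpectrum (𝓞 M) :=
  letI : Algebra M L := σ.toAlgebra
  w.under (𝓞 M)

/-- The ramification index `e(w | σ⁻¹ w)` of `𝓞 M → 𝓞 L` along `σ`. [cite: MochizukiFrdI2008, Ex. 6.3 p.113] -/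
def ramIdx (σ : M →+* L) (w : HeightOneSpectrum (𝓞 L)) : ℕ :=
  letI : Algebra M L := σ.toAlgebra
  Ideal.ramificationIdx' (under σ w).asIdeal w.asIdeal

omit [NumberField M] [NumberField L] in
/-- The prime below is the preimage under the induced map of rings of integers.
[cite: MochizukiFrdI2008, Ex. 6.3 p.113] -/
theorem under_asIdeal (σ : M →+* L) (w : HeightOneSpectrum (𝓞 L)) :
    (under σ w).asIdeal = Ideal.comap (RingOfIntegers.mapRingHom σ) w.asIdeal := rfl

/-- **`ord_w(σ x) = e(w|v) · ord_v(x)`**, `v = σ⁻¹ w` (Mathlib `HeightOneSpectrum.valuation_liesOver`).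
[cite: MochizukiFrdI2008, Ex. 6.3 p.113] -/
theorem valuation_apply (σ : M →+* L) (w : HeightOneSpectrum (𝓞 L)) (x : M) :
    w.valuation L (σ x) = ((under σ w).valuation M x) ^ ramIdx σ w := by
  letI : Algebra M L := σ.toAlgebra
  haveI : w.asIdeal.LiesOver (under σ w).asIdeal := ⟨rfl⟩
  exact (HeightOneSpectrum.valuation_liesOver L (under σ w) w x).symm

omit [NumberField M] in
/-- `σ⁻¹` of a prime along the identity is the prime itself. [cite: MochizukiFrdI2008, Ex. 6.3 p.113] -/
theorem under_id (w : HeightOneSpectrum (𝓞 M)) : under (RingHom.id M) w = w := by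
  apply HeightOneSpectrum.ext
  rw [under_asIdeal]
  have : RingOfIntegers.mapRingHom (RingHom.id M) = RingHom.id (𝓞 M) :=
    RingHom.ext fun x => RingOfIntegers.ext rfl
  rw [this, Ideal.comap_id]

omit [NumberField M] [NumberField L] [NumberField N] in
/-- `(τ ∘ σ)⁻¹ w = σ⁻¹ (τ⁻¹ w)`. [cite: MochizukiFrdI2008, Ex. 6.3 p.113] -/
theorem under_comp (σ : M →+* L) (τ : L →+* N) (w : HeightOneSpectrum (𝓞 N)) :
    under (τ.comp σ) w = under σ (under τ w) := by
  apply HeightOneSpectrum.ext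
  rw [under_asIdeal, under_asIdeal, under_asIdeal, Ideal.comap_comap]
  have : RingOfIntegers.mapRingHom (τ.comp σ) =
      (RingOfIntegers.mapRingHom τ).comp (RingOfIntegers.mapRingHom σ) :=
    RingHom.ext fun x => RingOfIntegers.ext rfl
  rw [this]

/-- `e(w|w) = 1` along the identity. [cite: MochizukiFrdI2008, Ex. 6.3 p.113] -/
theorem ramIdx_id (w : HeightOneSpectrum (𝓞 M)) : ramIdx (RingHom.id M) w = 1 := by
  obtain ⟨π, hπ⟩ := w.valuation_exists_uniformizer M
  have h := valuation_apply (RingHom.id M) w π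
  rw [under_id, RingHom.id_apply, hπ, ← WithZero.exp_nsmul, WithZero.exp_inj] at h
  simp only [smul_neg, nsmul_eq_mul, mul_one] at h
  omega

/-- Multiplicativity of ramification indices in towers, along ring homomorphisms:
`e(w | (τσ)⁻¹ w) = e(τ⁻¹ w | σ⁻¹ τ⁻¹ w) · e(w | τ⁻¹ w)`. [cite: MochizukiFrdI2008, Ex. 6.3 p.113] -/
theorem ramIdx_comp (σ : M →+* L) (τ : L →+* N) (w : HeightOneSpectrum (𝓞 N)) :
    ramIdx (τ.comp σ) w = ramIdx σ (under τ w) * ramIdx τ w := by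
  obtain ⟨π, hπ⟩ := (under (τ.comp σ) w).valuation_exists_uniformizer M
  have h1 := valuation_apply (τ.comp σ) w π
  have h2 := valuation_apply τ w (σ π)
  rw [valuation_apply σ (under τ w) π, ← under_comp, ← pow_mul] at h2
  rw [RingHom.comp_apply, h2, hπ, ← WithZero.exp_nsmul, ← WithZero.exp_nsmul, WithZero.exp_inj] at h1
  simp only [smul_neg, nsmul_eq_mul, mul_one, neg_inj] at h1
  exact_mod_cast h1.symm

omit [NumberField M] in
/-- Only finitely many primes of `L` lie over a given prime of `M` (they divide its extension).
[cite: MochizukiFrdI2008, Ex. 6.3 p.113] -/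
theorem finite_setOf_under_eq (σ : M →+* L) (v : HeightOneSpectrum (𝓞 M)) :
    {w : HeightOneSpectrum (𝓞 L) | under σ w = v}.Finite := by
  have hne : Ideal.map (RingOfIntegers.mapRingHom σ) v.asIdeal ≠ ⊥ :=
    fun h => v.ne_bot ((Ideal.map_eq_bot_iff_of_injective (mapRingHom_injective σ)).mp h)
  refine (Ideal.finite_factors hne).subset fun w hw => ?_
  simp only [Set.mem_setOf_eq] at hw ⊢
  rw [Ideal.dvd_iff_le, ← hw, under_asIdeal]
  exact Ideal.map_comap_le

/-! ### The same data indexed by Mathlib's finite places -/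

/-- `σ⁻¹ w` for finite places. [cite: MochizukiFrdI2008, Ex. 6.3 p.113] -/
def underPlace (σ : M →+* L) (w : FinitePlace L) : FinitePlace M :=
  FinitePlace.mk (under σ w.maximalIdeal)

/-- `e(w | σ⁻¹ w)` for finite places. [cite: MochizukiFrdI2008, Ex. 6.3 p.113] -/
def ramIdxPlace (σ : M →+* L) (w : FinitePlace L) : ℕ := ramIdx σ w.maximalIdeal

/-- The maximal ideal of `σ⁻¹ w`. [cite: MochizukiFrdI2008, Ex. 6.3 p.113] -/
@[simp] theorem maximalIdeal_underPlace (σ : M →+* L) (w : FinitePlace L) :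
    (underPlace σ w).maximalIdeal = under σ w.maximalIdeal :=
  FinitePlace.maximalIdeal_mk _

/-- `σ⁻¹` along the identity, finite places. [cite: MochizukiFrdI2008, Ex. 6.3 p.113] -/
theorem underPlace_id (w : FinitePlace M) : underPlace (RingHom.id M) w = w := by
  rw [underPlace, under_id, FinitePlace.mk_maximalIdeal]

/-- `(τσ)⁻¹ = σ⁻¹ τ⁻¹`, finite places. [cite: MochizukiFrdI2008, Ex. 6.3 p.113] -/
theorem underPlace_comp (σ : M →+* L) (τ : L →+* N) (w : FinitePlace N) :
    underPlace (τ.comp σ) w = underPlace σ (underPlace τ w) := by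
  rw [underPlace, underPlace, under_comp, underPlace, FinitePlace.maximalIdeal_mk]

/-- `e = 1` along the identity, finite places. [cite: MochizukiFrdI2008, Ex. 6.3 p.113] -/
theorem ramIdxPlace_id (w : FinitePlace M) : ramIdxPlace (RingHom.id M) w = 1 := ramIdx_id _

/-- Multiplicativity of `e`, finite places. [cite: MochizukiFrdI2008, Ex. 6.3 p.113] -/
theorem ramIdxPlace_comp (σ : M →+* L) (τ : L →+* N) (w : FinitePlace N) :
    ramIdxPlace (τ.comp σ) w = ramIdxPlace σ (underPlace τ w) * ramIdxPlace τ w := by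
  rw [ramIdxPlace, ramIdx_comp, ramIdxPlace, ramIdxPlace, maximalIdeal_underPlace]

/-- Finitely many finite places of `L` lie over a finite place of `M`. [cite: MochizukiFrdI2008, Ex. 6.3 p.113] -/
theorem finite_setOf_underPlace_eq (σ : M →+* L) (v : FinitePlace M) :
    {w : FinitePlace L | underPlace σ w = v}.Finite := by
  have h := (finite_setOf_under_eq σ v.maximalIdeal).preimage
    (FinitePlace.maximalIdeal_injective (K := L)).injOn
  refine h.subset fun w hw => ?_
  simp only [Set.mem_setOf_eq, Set.mem_preimage] at hw ⊢
  rw [← hw, maximalIdeal_underPlace]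

/-- The pull-back of a finitely supported coefficient vector on the finite places of `M`: at `w` the
coefficient of `σ⁻¹ w` times `e(w | σ⁻¹ w)` ("coefficient × ramification index, summed over the places
above"). [cite: MochizukiFrdI2008, Ex. 6.3 p.113] -/
def pullFinsupp (σ : M →+* L) {R : Type*} [Semiring R] (D : FinitePlace M →₀ R) : FinitePlace L →₀ R :=
  Finsupp.ofSupportFinite (fun w => (ramIdxPlace σ w : R) * D (underPlace σ w)) (by
    refine ((D.support.finite_toSet.biUnion fun v _ => finite_setOf_underPlace_eq σ v)).subset ?_
    intro w hw
    simp only [Function.mem_support, ne_eq] at hw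
    simp only [Set.mem_iUnion, Set.mem_setOf_eq, Finset.mem_coe, Finsupp.mem_support_iff]
    exact ⟨underPlace σ w, fun h => hw (by rw [h, mul_zero]), rfl⟩)

/-- Coefficients of the pull-back. [cite: MochizukiFrdI2008, Ex. 6.3 p.113] -/
@[simp] theorem pullFinsupp_apply (σ : M →+* L) {R : Type*} [Semiring R] (D : FinitePlace M →₀ R)
    (w : FinitePlace L) : pullFinsupp σ D w = (ramIdxPlace σ w : R) * D (underPlace σ w) := rfl

/-- Additivity of the finite pull-back. [cite: MochizukiFrdI2008, Ex. 6.3 p.113] -/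
theorem pullFinsupp_add (σ : M →+* L) {R : Type*} [Semiring R] (D E : FinitePlace M →₀ R) :
    pullFinsupp σ (D + E) = pullFinsupp σ D + pullFinsupp σ E := by
  ext w
  simp [mul_add]

/-- The finite pull-back of `0`. [cite: MochizukiFrdI2008, Ex. 6.3 p.113] -/
theorem pullFinsupp_zero (σ : M →+* L) {R : Type*} [Semiring R] :
    pullFinsupp σ (0 : FinitePlace M →₀ R) = 0 := by
  ext w
  simp

end ArithPullback

open ArithPullback

/-! ### The pull-back of effective arithmetic divisors and of arithmetic divisors -/

/-- **Pull-back of effective arithmetic divisors** `σ^* : Φ(M) → Φ(L)` along an embedding of number fields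
(FrdI Ex. 6.3 p. 113, "functorial"): `(σ^* D)_w = e(w|v) D_v` at finite `w | v`, `(σ^* D)_w = D_{w|_M}` at
archimedean `w`. [cite: MochizukiFrdI2008, Ex. 6.3 p.113] -/
def EffArithDivisor.pullback (σ : M →+* L) : EffArithDivisor M →+ EffArithDivisor L where
  toFun D := (pullFinsupp σ D.1, fun w => D.2 (w.comap σ))
  map_zero' := Prod.ext (pullFinsupp_zero σ) (funext fun _ => rfl)
  map_add' D E := Prod.ext (pullFinsupp_add σ D.1 E.1) (funext fun _ => rfl)

/-- **Pull-back of arithmetic divisors** `σ^* : Φ(M)^gp → Φ(L)^gp` (same formula with `ℤ`/`ℝ` coefficients).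
[cite: MochizukiFrdI2008, Ex. 6.3 p.113] -/
def ArithDivisor.pullback (σ : M →+* L) : ArithDivisor M →+ ArithDivisor L where
  toFun d := (pullFinsupp σ d.1, fun w => d.2 (w.comap σ))
  map_zero' := Prod.ext (pullFinsupp_zero σ) (funext fun _ => rfl)
  map_add' d e := Prod.ext (pullFinsupp_add σ d.1 e.1) (funext fun _ => rfl)

/-- Finite coefficients of `σ^* D`. [cite: MochizukiFrdI2008, Ex. 6.3 p.113] -/
@[simp] theorem EffArithDivisor.pullback_fst (σ : M →+* L) (D : EffArithDivisor M) (w : FinitePlace L) :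
    (EffArithDivisor.pullback σ D).1 w = ramIdxPlace σ w * D.1 (underPlace σ w) := rfl

/-- Archimedean coordinates of `σ^* D`. [cite: MochizukiFrdI2008, Ex. 6.3 p.113] -/
@[simp] theorem EffArithDivisor.pullback_snd (σ : M →+* L) (D : EffArithDivisor M) (w : InfinitePlace L) :
    (EffArithDivisor.pullback σ D).2 w = D.2 (w.comap σ) := rfl

/-- Finite coefficients of `σ^* d`. [cite: MochizukiFrdI2008, Ex. 6.3 p.113] -/
@[simp] theorem ArithDivisor.pullback_fst (σ : M →+* L) (d : ArithDivisor M) (w : FinitePlace L) :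
    (ArithDivisor.pullback σ d).1 w = (ramIdxPlace σ w : ℤ) * d.1 (underPlace σ w) := rfl

/-- Archimedean coordinates of `σ^* d`. [cite: MochizukiFrdI2008, Ex. 6.3 p.113] -/
@[simp] theorem ArithDivisor.pullback_snd (σ : M →+* L) (d : ArithDivisor M) (w : InfinitePlace L) :
    (ArithDivisor.pullback σ d).2 w = d.2 (w.comap σ) := rfl

/-- The pull-backs commute with `Φ ⊆ Φ^gp`. [cite: MochizukiFrdI2008, Ex. 6.3 p.113] -/
theorem EffArithDivisor.toArithDivisor_pullback (σ : M →+* L) (D : EffArithDivisor M) :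
    EffArithDivisor.toArithDivisor L (EffArithDivisor.pullback σ D) =
      ArithDivisor.pullback σ (EffArithDivisor.toArithDivisor M D) := by
  refine Prod.ext (Finsupp.ext fun w => ?_) (funext fun w => ?_)
  · simp
  · simp

/-- **Functoriality**: `id^* = id` on `Φ`. [cite: MochizukiFrdI2008, Ex. 6.3 p.113] -/
theorem EffArithDivisor.pullback_id (D : EffArithDivisor M) :
    EffArithDivisor.pullback (RingHom.id M) D = D := by
  refine Prod.ext (Finsupp.ext fun w => ?_) (funext fun w => ?_)
  · simp [underPlace_id, ramIdxPlace_id]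
  · simp [InfinitePlace.comap_id]

/-- **Functoriality**: `(τσ)^* = τ^* ∘ σ^*` on `Φ`. [cite: MochizukiFrdI2008, Ex. 6.3 p.113] -/
theorem EffArithDivisor.pullback_comp (σ : M →+* L) (τ : L →+* N) (D : EffArithDivisor M) :
    EffArithDivisor.pullback (τ.comp σ) D = EffArithDivisor.pullback τ (EffArithDivisor.pullback σ D) := by
  refine Prod.ext (Finsupp.ext fun w => ?_) (funext fun w => ?_)
  · simp [underPlace_comp, ramIdxPlace_comp, mul_comm, mul_assoc]
  · simp [InfinitePlace.comap_comp]

/-- **Functoriality**: `id^* = id` on `Φ^gp`. [cite: MochizukiFrdI2008, Ex. 6.3 p.113] -/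
theorem ArithDivisor.pullback_id (d : ArithDivisor M) : ArithDivisor.pullback (RingHom.id M) d = d := by
  refine Prod.ext (Finsupp.ext fun w => ?_) (funext fun w => ?_)
  · simp [underPlace_id, ramIdxPlace_id]
  · simp [InfinitePlace.comap_id]

/-- **Functoriality**: `(τσ)^* = τ^* ∘ σ^*` on `Φ^gp`. [cite: MochizukiFrdI2008, Ex. 6.3 p.113] -/
theorem ArithDivisor.pullback_comp (σ : M →+* L) (τ : L →+* N) (d : ArithDivisor M) :
    ArithDivisor.pullback (τ.comp σ) d = ArithDivisor.pullback τ (ArithDivisor.pullback σ d) := by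
  refine Prod.ext (Finsupp.ext fun w => ?_) (funext fun w => ?_)
  · simp [underPlace_comp, ramIdxPlace_comp, mul_comm, mul_assoc]
  · simp [InfinitePlace.comap_comp]

/-! ### Compatibility with principal divisors: `σ^* div(f) = div(σ f)` -/

/-- `ord_v` and the valuation: `exp(-ord_v x) = val_v(x)` in `ℤᵐ⁰`. [cite: MochizukiFrdI2008, Ex. 6.3 p.112] -/
theorem exp_neg_ordFin {F : Type*} [Field F] [NumberField F] (v : FinitePlace F) (x : Fˣ) :
    WithZero.exp (-ordFin F v x) = v.maximalIdeal.valuation F (x : F) := by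
  unfold ordFin
  rw [neg_neg, WithZero.exp_eq_coe_ofAdd, ofAdd_toAdd, WithZero.coe_unzero]

/-- **`ord_w(σ f) = e(w | σ⁻¹ w) · ord_{σ⁻¹ w}(f)`** (FrdI Ex. 6.3 p. 113, functoriality of `B → Φ^gp` at the
finite places). [cite: MochizukiFrdI2008, Ex. 6.3 p.113] -/
theorem ordFin_map (σ : M →+* L) (w : FinitePlace L) (f : Mˣ) :
    ordFin L w (Units.map (σ : M →* L) f) = ramIdxPlace σ w * ordFin M (underPlace σ w) f := by
  apply neg_injective
  apply WithZero.exp_injective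
  rw [exp_neg_ordFin, Units.coe_map, MonoidHom.coe_coe, valuation_apply σ w.maximalIdeal,
    ← maximalIdeal_underPlace, ← exp_neg_ordFin, ← WithZero.exp_nsmul]
  congr 1
  simp [ramIdxPlace]

/-- **`σ^* div(f) = div(σ f)`** — functoriality of the principal-divisor map `B → Φ^gp` of Ex. 6.3 (FrdI
p. 113). [cite: MochizukiFrdI2008, Ex. 6.3 p.113] -/
theorem ArithDivisor.pullback_principalArithDivisor (σ : M →+* L) (f : Mˣ) :
    ArithDivisor.pullback σ (principalArithDivisor M f) = principalArithDivisor L (Units.map (σ : M →* L) f) := by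
  refine Prod.ext (Finsupp.ext fun w => ?_) (funext fun w => ?_)
  · rw [ArithDivisor.pullback_fst, principalArithDivisor_fst, principalArithDivisor_fst, ordFin_map]
  · simp [InfinitePlace.comap_apply]

/-- The compatibility in the exact form used by abc-iut-L1-t3's interface `ArithDivisorMonoidOn.pull_div`:
if `D - E = div(f)` in `Φ(M)^gp` for effective `D, E`, then `σ^*D - σ^*E = div(σ f)` in `Φ(L)^gp`.
[cite: MochizukiFrdI2008, Ex. 6.3 p.113] -/
theorem EffArithDivisor.pullback_sub_eq_principal (σ : M →+* L) (f : Mˣ) (D E : EffArithDivisor M)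
    (h : EffArithDivisor.toArithDivisor M D - EffArithDivisor.toArithDivisor M E = principalArithDivisor M f) :
    EffArithDivisor.toArithDivisor L (EffArithDivisor.pullback σ D) -
        EffArithDivisor.toArithDivisor L (EffArithDivisor.pullback σ E) =
      principalArithDivisor L (Units.map (σ : M →* L) f) := by
  rw [EffArithDivisor.toArithDivisor_pullback, EffArithDivisor.toArithDivisor_pullback, ← map_sub, h,
    ArithDivisor.pullback_principalArithDivisor]

end Literature.AlgebraicGeometry.Frobenioids

end
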